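import Summits.ResolutionOfSingularities.ResolutionOfSingularities.Theorems.FaceFormCutClasses

/-!
# NearExit (S5) — face transfer: order of the dehomogenised face form at a point of the chart
# bounds the geometric multiplicity of the face form

Node «NearExit» of `decomp-res-lens-2` (g33).  `P ∈ K[X₀, …, X_{D-1}]` a FORM of degree `N` (the geometric face
form `geomFace G`), `j` a chart index, `v` a vector with `v_j = 1` (the direction of a closed point of the chart
`{X_j ≠ 0}` of `ℙ^{D-1}`), `m` a threshold.  The chart coordinate of the point is `v` itself and the face form
read in the chart is the dehomogenisation `δ_j P = P(X_j ↦ 1)`.  MAIN RESULT `not_multLT_of_mem_pow`: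

  `(δ_j P)(X + v) ∈ (X₀, …, X_{D-1})^m  ⇒  ¬ MultLT P v m`,

i.e. if `δ_j P` vanishes to order `≥ m` at the point `v` of the chart then EVERY monomial of the Taylor translate
`P(X + v)` has degree `≥ m`.  Proof (pure polynomial algebra, characteristic-free): with the linear change of
variables `γ : X_i ↦ X_i + v_i X_j (i ≠ j), X_j ↦ X_j` one has `γ(P(X+v)) = (γP)(X_j ↦ X_j + 1)` and
`(δ_j P)(X + v) = (γP)(X_j ↦ 1)` (this uses `v_j = 1`); `γP` is again a form of degree `N`, and for a FORM `R`
the monomials of `R(X_j ↦ 1)` are the `X^{α - α_j e_j}`, `α ∈ supp R`, WITHOUT cancellation (`α_j = N - |α - α_j e_j|`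
is determined), so `R(X_j ↦ 1) ∈ 𝔙^m` forces `|α| - α_j ≥ m` on `supp R`, whence `R(X_j ↦ X_j + 1) =
Σ c_α X^{α - α_j e_j} (X_j + 1)^{α_j} ∈ 𝔙^m`; finally `γ⁻¹` preserves `𝔙 = (X₀, …, X_{D-1})`.

Sources: [CossartPiltant2008] §4 (reading the face form in a chart of the first blow-up); [Hironaka1964] Ch. III
(multiplicity of a form at a point of the projectivised tangent cone); Mathlib `MvPolynomial.mem_pow_idealOfVars_iff`.
-/

open MvPolynomial

namespace Summit.ResolutionOfSingularities.ResolutionOfSingularities.Theorems.NearExit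

section Face

variable {K : Type} [CommRing K] {D : ℕ}

/-- The product `∏ (update X j q i)^{α i}` splits off the `j`-th factor: it is `q^{α_j} · X^{α - α_j e_j}`. [folklore] -/
theorem prod_update_pow (j : Fin D) (q : MvPolynomial (Fin D) K) (α : Fin D →₀ ℕ) :
    (α.prod fun i e => (Function.update X j q i) ^ e) = q ^ (α j) * monomial (Finsupp.erase j α) (1 : K) := by
  classical
  have hsplit := Finsupp.erase_add_single j α
  conv_lhs => rw [← hsplit]
  rw [Finsupp.prod_add_index' (h := fun i e => Function.update X j q i ^ e) (fun i => pow_zero _)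
      (fun i a b => pow_add _ a b),
    Finsupp.prod_single_index (h := fun i e => Function.update X j q i ^ e) (pow_zero _)]
  simp only [Function.update_self]
  rw [mul_comm, monic_monomial_eq]
  congr 1
  refine Finsupp.prod_congr fun i hi => ?_
  have hij : i ≠ j := by
    rintro rfl
    rw [Finsupp.mem_support_iff, Finsupp.erase_same] at hi
    exact hi rfl
  simp only [Function.update_of_ne hij]

/-- Dehomogenisation / `j`-translation of a monomial. [folklore] -/
theorem aeval_update_monomial (j : Fin D) (q : MvPolynomial (Fin D) K) (α : Fin D →₀ ℕ) (a : K) :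
    aeval (Function.update X j q) (monomial α a) = C a * q ^ (α j) * monomial (Finsupp.erase j α) (1 : K) := by
  rw [aeval_monomial, prod_update_pow, mul_assoc]
  rfl

/-- On the support of a form, the exponent `α` is recovered from `α - α_j e_j`. [folklore] -/
theorem erase_injOn_of_isHomogeneous (j : Fin D) {R : MvPolynomial (Fin D) K} {N : ℕ}
    (hR : R.IsHomogeneous N) {α β : Fin D →₀ ℕ} (hα : α ∈ R.support) (hβ : β ∈ R.support)
    (h : Finsupp.erase j α = Finsupp.erase j β) : α = β := by
  classical
  have key : ∀ γ ∈ R.support, (Finsupp.erase j γ).degree + γ j = N := by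
    intro γ hγ
    have hN : γ.degree = N := by
      rw [Finsupp.degree_eq_weight_one]; exact hR (mem_support_iff.mp hγ)
    have hsplit := Finsupp.erase_add_single j γ
    rw [← hN]
    conv_rhs => rw [← hsplit]
    rw [map_add, Finsupp.degree_single]
  have hdα := key α hα
  have hdβ := key β hβ
  have hj : α j = β j := by rw [h] at hdα; omega
  rw [← Finsupp.erase_add_single j α, ← Finsupp.erase_add_single j β, h, hj]

/-- **No cancellation under dehomogenisation of a form**: the coefficient of `X^{α - α_j e_j}` in `R(X_j ↦ 1)` is the
coefficient of `X^α` in `R`. [folklore] -/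
theorem coeff_erase_aeval_update_one (j : Fin D) {R : MvPolynomial (Fin D) K} {N : ℕ}
    (hR : R.IsHomogeneous N) {α : Fin D →₀ ℕ} (hα : α ∈ R.support) :
    coeff (Finsupp.erase j α) (aeval (Function.update X j 1) R) = coeff α R := by
  classical
  conv_lhs => rw [R.as_sum, map_sum]
  simp only [aeval_update_monomial, one_pow, mul_one, coeff_sum, coeff_C_mul, coeff_monomial, mul_ite,
    mul_zero]
  rw [Finset.sum_eq_single α]
  · simp
  · intro β hβ hβα
    rw [if_neg]
    intro h
    exact hβα (erase_injOn_of_isHomogeneous j hR hβ hα h)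
  · intro h; exact absurd hα h

/-- **Dehomogenised order controls the translated form**: for a form `R` of degree `N`, if every monomial of
`R(X_j ↦ 1)` has degree `≥ m` then so does every monomial of `R(X_j ↦ X_j + 1)`. [folklore] -/
theorem aeval_update_add_one_mem_pow (j : Fin D) {R : MvPolynomial (Fin D) K} {N : ℕ} (hR : R.IsHomogeneous N)
    {m : ℕ} (h : aeval (Function.update X j 1) R ∈ idealOfVars (Fin D) K ^ m) :
    aeval (Function.update X j (X j + 1)) R ∈ idealOfVars (Fin D) K ^ m := by
  classical
  rw [mem_pow_idealOfVars_iff] at h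
  -- every exponent of `R` has `|α| - α_j ≥ m`
  have hdeg : ∀ α ∈ R.support, m ≤ (Finsupp.erase j α).degree := by
    intro α hα
    apply h
    rw [mem_support_iff, coeff_erase_aeval_update_one j hR hα]
    exact mem_support_iff.mp hα
  rw [R.as_sum, map_sum]
  refine Ideal.sum_mem _ fun α hα => ?_
  rw [aeval_update_monomial]
  refine Ideal.mul_mem_left _ _ (Ideal.pow_le_pow_right (hdeg α hα) ?_)
  rw [mem_pow_idealOfVars_iff]
  intro x hx
  rw [Finset.mem_singleton.mp (support_monomial_subset hx)]

/-! ### The linear change of variables `γ_v : X_i ↦ X_i + v_i X_j (i ≠ j), X_j ↦ X_j` -/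

/-- `γ_v ∘ (X ↦ X + v) = (X_j ↦ X_j + 1) ∘ γ_v` when `v_j = 1`. [folklore] -/
theorem shear_comp_translate (j : Fin D) (v : Fin D → K) (hvj : v j = 1) :
    (aeval (Function.update (fun i => X i + C (v i) * X j) j (X j : MvPolynomial (Fin D) K))).comp
        (aeval fun i => X i + C (v i)) =
      (aeval (Function.update X j (X j + 1))).comp
        (aeval (Function.update (fun i => X i + C (v i) * X j) j (X j : MvPolynomial (Fin D) K))) := by
  refine algHom_ext fun i => ?_
  by_cases hij : i = j
  · subst hij
    simp [hvj]
  · simp [Function.update_of_ne hij, mul_add, add_assoc]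

/-- `(X_j ↦ 1) ∘ γ_v = (X ↦ X + v) ∘ (X_j ↦ 1)`. [folklore] -/
theorem dehomog_comp_shear (j : Fin D) (v : Fin D → K) :
    (aeval (Function.update X j (1 : MvPolynomial (Fin D) K))).comp
        (aeval (Function.update (fun i => X i + C (v i) * X j) j (X j : MvPolynomial (Fin D) K))) =
      (aeval fun i => X i + C (v i)).comp (aeval (Function.update X j (1 : MvPolynomial (Fin D) K))) := by
  refine algHom_ext fun i => ?_
  by_cases hij : i = j
  · subst hij
    simp
  · simp [Function.update_of_ne hij]

/-- `γ_v` carries forms to forms of the same degree. [folklore] -/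
theorem isHomogeneous_shear (j : Fin D) (v : Fin D → K) {P : MvPolynomial (Fin D) K} {N : ℕ}
    (hP : P.IsHomogeneous N) :
    (aeval (Function.update (fun i => X i + C (v i) * X j) j (X j : MvPolynomial (Fin D) K)) P).IsHomogeneous
      N := by
  have := hP.aeval (Function.update (fun i => X i + C (v i) * X j) j (X j : MvPolynomial (Fin D) K))
    (n := 1) fun i => ?_
  · simpa using this
  · by_cases hij : i = j
    · subst hij
      rw [Function.update_self]
      exact isHomogeneous_X K i
    · rw [Function.update_of_ne hij]
      exact (isHomogeneous_X K i).add (isHomogeneous_C_mul_X (v i) j)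

/-- `γ_v⁻¹ ∘ γ_v = id` with `γ_v⁻¹ : X_i ↦ X_i − v_i X_j (i ≠ j), X_j ↦ X_j`. [folklore] -/
theorem unshear_comp_shear (j : Fin D) (v : Fin D → K) :
    (aeval (Function.update (fun i => X i - C (v i) * X j) j (X j : MvPolynomial (Fin D) K))).comp
        (aeval (Function.update (fun i => X i + C (v i) * X j) j (X j : MvPolynomial (Fin D) K))) =
      AlgHom.id K _ := by
  refine algHom_ext fun i => ?_
  by_cases hij : i = j
  · subst hij
    simp
  · simp [Function.update_of_ne hij]

/-- `γ_v⁻¹` preserves the powers of the irrelevant ideal `𝔙 = (X₀, …, X_{D-1})`. [folklore] -/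
theorem unshear_mem_pow (j : Fin D) (v : Fin D → K) {m : ℕ} {f : MvPolynomial (Fin D) K}
    (hf : f ∈ idealOfVars (Fin D) K ^ m) :
    aeval (Function.update (fun i => X i - C (v i) * X j) j (X j : MvPolynomial (Fin D) K)) f ∈
      idealOfVars (Fin D) K ^ m := by
  set g : MvPolynomial (Fin D) K →ₐ[K] MvPolynomial (Fin D) K :=
    aeval (Function.update (fun i => X i - C (v i) * X j) j (X j : MvPolynomial (Fin D) K)) with hg
  have hle : (idealOfVars (Fin D) K).map g ≤ idealOfVars (Fin D) K := by
    rw [idealOfVars, Ideal.map_span]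
    refine Ideal.span_le.mpr ?_
    rintro _ ⟨_, ⟨i, rfl⟩, rfl⟩
    by_cases hij : i = j
    · subst hij
      rw [hg, aeval_X, Function.update_self]
      exact Ideal.subset_span ⟨i, rfl⟩
    · rw [hg, aeval_X, Function.update_of_ne hij]
      exact Ideal.sub_mem _ (Ideal.subset_span ⟨i, rfl⟩)
        (Ideal.mul_mem_left _ _ (Ideal.subset_span ⟨j, rfl⟩))
  have := Ideal.mem_map_of_mem g hf
  rw [Ideal.map_pow] at this
  exact Ideal.pow_right_mono hle m this

end Face

section FaceField

variable {K : Type} [Field K] {D : ℕ}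

/-- **FACE TRANSFER (MAIN).**  `P` a form, `v_j = 1`: if the dehomogenisation `P(X_j ↦ 1)` vanishes to order `≥ m`
at the point `v` of the chart — `(P(X_j ↦ 1))(X + v) ∈ (X₀, …, X_{D-1})^m` — then EVERY monomial of the Taylor
translate `P(X + v)` has degree `≥ m`, i.e. `¬ MultLT P v m`. [cite: CossartPiltant2008, §4] -/
theorem not_multLT_of_mem_pow (j : Fin D) {P : MvPolynomial (Fin D) K} {N : ℕ} (hP : P.IsHomogeneous N)
    (v : Fin D → K) (hvj : v j = 1) {m : ℕ}
    (h : aeval (fun i => X i + C (v i)) (aeval (Function.update X j (1 : MvPolynomial (Fin D) K)) P) ∈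
      idealOfVars (Fin D) K ^ m) :
    ¬ FaceFormCutClasses.MultLT P v m := by
  -- `(γP)(X_j ↦ 1) ∈ 𝔙^m`
  have h1 : aeval (Function.update X j (1 : MvPolynomial (Fin D) K))
      (aeval (Function.update (fun i => X i + C (v i) * X j) j (X j : MvPolynomial (Fin D) K)) P) ∈
      idealOfVars (Fin D) K ^ m := by
    rw [← AlgHom.comp_apply, dehomog_comp_shear j v, AlgHom.comp_apply]
    exact h
  -- `(γP)(X_j ↦ X_j + 1) ∈ 𝔙^m`, i.e. `γ(P(X + v)) ∈ 𝔙^m`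
  have h2 := aeval_update_add_one_mem_pow j (isHomogeneous_shear j v hP) h1
  rw [← AlgHom.comp_apply, ← shear_comp_translate j v hvj, AlgHom.comp_apply] at h2
  -- undo `γ`
  have h3 := unshear_mem_pow j v h2
  rw [← AlgHom.comp_apply, unshear_comp_shear, AlgHom.id_apply] at h3
  rw [mem_pow_idealOfVars_iff] at h3
  rintro ⟨α, hα, hlt⟩
  have := h3 α hα
  rw [Finsupp.degree_apply] at this
  exact absurd hlt (not_lt.mpr this)

end FaceField

end Summit.ResolutionOfSingularities.ResolutionOfSingularities.Theorems.NearExit
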